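import Summits.AnomalousDissipation.AnomalousDissipation.Theorems.SolenoidalFractalHomogenisationLagrangianStepVmodBridge
import Summits.AnomalousDissipation.AnomalousDissipation.Theorems.SolenoidalFractalHomogenisationLagrangianStepVmodLinkForcing
import Summits.AnomalousDissipation.AnomalousDissipation.Theorems.SolenoidalFractalHomogenisationLagrangianStepVmodFlatBlocks
import Literature.Analysis.FluidPDE.PassiveVectorTensorSlowLeakage
import HarnessLib

/-!
# K1L_D (stmt-AnomalousDissipation-27980): (V_mod) flat stage, block (ss) — THE SLOW LEAKAGE OF A FAST CLASS-PAIR DATUM, at the propagator level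
# (tool L-lk of the certifier's table `Cruxes/LagrangianRenormalisationStep/Lines/onelevel-ss-regimes.md`, row «C / coarse / y ≥ 1»)
(helper; `--supports 27980 --as helper`; prover ad-sawtooth-k1loc-p1 g15; on top of `…VmodBridge` and the Literature brick
`PassiveVectorTensorSlowLeakage.ae_block_energy_le_of_datum_off_block` (a spectrally separated block that starts empty stays almost empty).)

Cell units: `U` the propagator of the cell problem (carrier `W₁.cell n`, tensor `(1/n²)•𝔸`, `NearIso 𝔸 lo hi`, `lo > 0`) on `[0,T₀]`, a window start `s`
at carrier phase 0, a slow label `ℓ ≠ 0` with `2|ℓ| < n`, and a weakly divergence-free `f ∈ V2` carried by the class pair of `ℓ` WITHOUT the pair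
itself (`𝓕f(±ℓ) = 0`: the «fast» part of a class-pair state).  Then at every `t ∈ [s, T₀]`

  `‖𝓕(U s t f)(ℓ)‖ ≤ (12·k₀·(√|ℓ|²/n)/(π²·lo)) · exp(18·k₀²·(|ℓ|²/n²)·(t−s)/(π²·lo)) · ‖f‖`   (`norm_fc_slow_le_of_fast`),

`k₀` the number of slots of the word (carrier bound `‖W₁.cell n‖ ≤ k₀/(2πn)`, `norm_cell_le_div`), spectral separation `|k|² ≥ n²/4` off `{±ℓ}` by
class-pair confinement.  With `lo = ν·lo/Λ` the prefactor is `∝ (|ℓ|/n)/(ν lo′)` = the sideband ratio `g̃` of the table, and over a grid step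
`t − s ≲ P/x²` the exponent is a constant.  `sorry`-free; NOT a proof of (ss), of the stub, of K1L_D or of AD; rung F-D1.A0.
-/

set_option linter.dupNamespace false

noncomputable section

namespace Summit.AnomalousDissipation.AnomalousDissipation.Theorems.SolenoidalFractalHomogenisation.LagrangianStep.VmodGen

open Set MeasureTheory Complex UnitAddTorus
open scoped InnerProductSpace ENNReal
open Literature.Analysis Literature.Analysis.FunctionSpaces Literature.Analysis.FunctionSpaces.Torus
open Literature.Analysis.FluidPDE Literature.Analysis.FluidPDE.Torus Literature.Analysis.FluidPDE.LatticeShear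
open Summit.AnomalousDissipation.AnomalousDissipation.Theorems.SolenoidalFractalHomogenisation.LagrangianStep.CellChain
  (modeRep continuousOn_modeRep ae_forall_eq_modeRep le_on_Icc_of_ae_le norm_latticeVec_ge_of_classPair_ne)
open Summit.AnomalousDissipation.AnomalousDissipation.Theorems.SolenoidalFractalHomogenisation.LagrangianStep.Sideband (ae_classPair_of_ne_zero_cell)
open Summit.AnomalousDissipation.AnomalousDissipation.Theorems.SolenoidalFractalHomogenisation.RealisedQuasiStaticCellLaw (memLp_top_stLift_cell)
open Summit.AnomalousDissipation.AnomalousDissipation.Theorems.SolenoidalFractalHomogenisation.LagrangianStep.VmodFlat (fc)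

variable {k₀ : ℕ}

set_option maxHeartbeats 1600000 in
/-- **SLOW LEAKAGE OF A FAST CLASS-PAIR DATUM, at the propagator level.**  See the module docstring.
[cite: RobinsonRodrigoSadowski2016, §4.2 (4.20)] [cite: Temam1984, Ch. III §1 Lemma 1.2] -/
theorem norm_fc_slow_le_of_fast (W₁ : LatticeWord k₀) {n : ℕ} (hn : n ≠ 0) {T₀ : ℝ} {𝔸 : Visc4 (Fin 3)} {lo hi : ℝ}
    (h𝔸 : NearIso 𝔸 lo hi) (hlo : 0 < lo)
    {U : ℝ → ℝ → (V2 →L[ℝ] V2)} (hU : IsPropagator T₀ (W₁.cell n) ((1 / (n : ℝ) ^ 2) • 𝔸) U)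
    {s t : ℝ} (hs : 0 ≤ s) (hst : s ≤ t) (htT : t ≤ T₀) (hsT : s < T₀) (hphase : ∀ τ, W₁.cell n (s + τ) = W₁.cell n τ)
    {ℓ : Fin 3 → ℤ} (hℓ0 : ℓ ≠ 0) (hℓ : 2 * Real.sqrt (freqNormSq ℓ) < n)
    (f : V2) (hf : FunctionSpaces.Torus.IsWeaklyDivFree (f : VF))
    (hfs : ∀ k, fc f k ≠ 0 → (∀ i, (n : ℤ) ∣ k i - ℓ i) ∨ (∀ i, (n : ℤ) ∣ k i + ℓ i))
    (hf1 : fc f ℓ = 0) (hf2 : fc f (-ℓ) = 0) :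
    ‖fc (U s t f) ℓ‖ ≤
      (12 * k₀ * (Real.sqrt (freqNormSq ℓ) / n) / (Real.pi ^ 2 * lo)) *
        Real.exp (18 * (k₀ : ℝ) ^ 2 * (freqNormSq ℓ / (n : ℝ) ^ 2) * (t - s) / (Real.pi ^ 2 * lo)) * ‖f‖ := by
  classical
  set 𝔹 := (1 / (n : ℝ) ^ 2) • 𝔸 with h𝔹def
  have hnpos : 0 < n := Nat.pos_of_ne_zero hn
  have hn0 : (0 : ℝ) < n := by exact_mod_cast hnpos
  have h𝔹 : NearIso 𝔹 (1 / (n : ℝ) ^ 2 * lo) (1 / (n : ℝ) ^ 2 * hi) := h𝔸.smul (by positivity)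
  have hlo' : 0 < 1 / (n : ℝ) ^ 2 * lo := by positivity
  set L : ℝ := T₀ - s with hL
  have hL0 : 0 < L := by rw [hL]; linarith
  have hfi : Integrable (f : VF) volume := integrable_coe_V2 f
  have hf2m : MemLp (f : VF) 2 volume := Lp.memLp f
  obtain ⟨u, hu, hUeq⟩ := exists_sol_forall_fcoeff_eq_modeRep W₁ n h𝔹 hlo' hU hs hsT hphase hf2m hf
  have hfeq : hf2m.toLp (f : VF) = f := Lp.toLp_coeFn f hf2m
  have hne : ℓ ≠ -ℓ := fun h' => hℓ0 (by
    funext i; have hi := congrFun h' i; simp only [Pi.neg_apply] at hi; have : ℓ i = 0 := by omega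
    simpa using this)
  set S : Finset (Fin 3 → ℤ) := {ℓ, -ℓ} with hS
  -- inputs of the Literature brick
  have hb : MemLp (FunctionSpaces.Torus.stLift (W₁.cell n)) ∞ (volume.restrict (Ioo 0 L ×ˢ (univ : Set (EuclideanSpace ℝ (Fin 3))))) :=
    memLp_top_stLift_cell W₁ n L
  have hM : (0:ℝ) ≤ k₀ / (2 * Real.pi * n) := by positivity
  have hbM : ∀ᵐ σ ∂(volume.restrict (Ioo 0 L)), ∀ᵐ x ∂(volume : Measure (UnitAddTorus (Fin 3))), ‖W₁.cell n σ x‖ ≤ k₀ / (2 * Real.pi * n) :=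
    ae_of_all _ fun σ => ae_of_all _ fun x => norm_cell_le_div W₁ hnpos σ x
  have hSsymm : ∀ k ∈ S, -k ∈ S := by
    intro k hk; rw [hS, Finset.mem_insert, Finset.mem_singleton] at hk ⊢
    rcases hk with rfl | rfl
    · right; rfl
    · left; rw [neg_neg]
  have hS₀ : ∀ k ∈ S, mFourierCoeff (FunctionSpaces.EuclideanSpace.complexify ∘ (f : VF)) k = 0 := by
    intro k hk; rw [hS, Finset.mem_insert, Finset.mem_singleton] at hk
    rcases hk with rfl | rfl
    · exact hf1
    · exact hf2
  have hκ₀ : 0 ≤ Real.sqrt (freqNormSq ℓ) := Real.sqrt_nonneg _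
  have hSκ : ∀ k ∈ S, freqNormSq k ≤ Real.sqrt (freqNormSq ℓ) ^ 2 := by
    intro k hk; rw [Real.sq_sqrt (freqNormSq_nonneg ℓ)]
    rw [hS, Finset.mem_insert, Finset.mem_singleton] at hk
    rcases hk with rfl | rfl
    · exact le_rfl
    · rw [freqNormSq_neg]
  have hρ : (0:ℝ) < (n : ℝ) ^ 2 / 4 := by positivity
  have hfs' : ∀ k, mFourierCoeff (FunctionSpaces.EuclideanSpace.complexify ∘ (f : VF)) k ≠ 0 →
      (∀ i, (n : ℤ) ∣ k i - ℓ i) ∨ (∀ i, (n : ℤ) ∣ k i + ℓ i) := hfs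
  have hℓn : 2 * ‖Torus.latticeVec ℓ‖ ≤ n := by
    have e : ‖Torus.latticeVec ℓ‖ = Real.sqrt (freqNormSq ℓ) := by
      rw [← norm_latticeVec_sq', Real.sqrt_sq (norm_nonneg _)]
    rw [e]; exact hℓ.le
  have hgap : ∀ᵐ σ ∂(volume.restrict (Ioo 0 L)), ∀ k, k ∉ S →
      mFourierCoeff (FunctionSpaces.EuclideanSpace.complexify ∘ u σ) k ≠ 0 → (n : ℝ) ^ 2 / 4 ≤ freqNormSq k := by
    filter_upwards [ae_classPair_of_ne_zero_cell W₁ hnpos h𝔸 hlo ℓ hf2m hfs' hu] with σ hσ k hkS hk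
    have hmem := hσ k hk
    rw [hS, Finset.mem_insert, Finset.mem_singleton, not_or] at hkS
    have hge := norm_latticeVec_ge_of_classPair_ne hmem hkS.1 hkS.2
    have hnn : 0 ≤ (n : ℝ) - ‖Torus.latticeVec ℓ‖ := by linarith [norm_nonneg (Torus.latticeVec ℓ)]
    have hsq : ((n : ℝ) - ‖Torus.latticeVec ℓ‖) ^ 2 ≤ freqNormSq k := by
      rw [← norm_latticeVec_sq']; exact pow_le_pow_left₀ hnn hge 2
    nlinarith [norm_nonneg (Torus.latticeVec ℓ)]
  -- the brick: a.e. on `(0, L)` the (empty-started) block stays almost empty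
  have hbrick := hu.ae_block_energy_le_of_datum_off_block h𝔹 hlo' hf2m hf hb hM hbM S hSsymm hS₀ hκ₀ hSκ hρ hgap
  -- read it on the representatives, then at every time by continuity
  set G : ℝ → ℝ := fun σ => (2 * Fintype.card (Fin 3) * (k₀ / (2 * Real.pi * n)) * Real.sqrt (freqNormSq ℓ)) ^ 2 /
      (Real.pi * (1 / (n : ℝ) ^ 2 * lo) * ((n : ℝ) ^ 2 / 4)) ^ 2 *
      Real.exp ((2 * Fintype.card (Fin 3) * (k₀ / (2 * Real.pi * n)) * Real.sqrt (freqNormSq ℓ)) ^ 2 /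
        ((1 / (n : ℝ) ^ 2 * lo) * ((n : ℝ) ^ 2 / 4)) * σ) * ∫ x, ‖(f : VF) x‖ ^ 2 with hG
  have hae : ∀ᵐ σ ∂(volume.restrict (Ioo 0 L)), ‖modeRep W₁ n 𝔹 (f : VF) u ℓ σ‖ ^ 2 ≤ G σ := by
    filter_upwards [hbrick, ae_forall_eq_modeRep W₁ n hL0.le hu hfi] with σ hσ hrep
    have hℓS : ℓ ∈ S := by rw [hS]; exact Finset.mem_insert_self _ _
    have h1 : ‖modeRep W₁ n 𝔹 (f : VF) u ℓ σ‖ ^ 2 ≤ ∑ k ∈ S, ‖mFourierCoeff (FunctionSpaces.EuclideanSpace.complexify ∘ u σ) k‖ ^ 2 := by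
      rw [← hrep ℓ]
      exact Finset.single_le_sum (f := fun k => ‖mFourierCoeff (FunctionSpaces.EuclideanSpace.complexify ∘ u σ) k‖ ^ 2)
        (fun k _ => sq_nonneg _) hℓS
    exact h1.trans hσ
  have hGc : ContinuousOn G (Icc 0 L) := by
    rw [hG]
    exact ((continuous_const.mul (Real.continuous_exp.comp (continuous_const.mul continuous_id))).mul continuous_const).continuousOn
  have hmc : ContinuousOn (fun σ => ‖modeRep W₁ n 𝔹 (f : VF) u ℓ σ‖ ^ 2) (Icc 0 L) := ((continuousOn_modeRep W₁ n hL0.le hu ℓ).norm).pow 2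
  have hall := le_on_Icc_of_ae_le hL0 hmc hGc hae
  have hτ : t - s ∈ Icc 0 L := ⟨by linarith, by rw [hL]; linarith⟩
  have key := hall (t - s) hτ
  have est : s + (t - s) = t := by ring
  have e1 : fc (U s t f) ℓ = modeRep W₁ n 𝔹 (f : VF) u ℓ (t - s) := by
    have h := hUeq (t - s) hτ ℓ
    rw [est, hfeq] at h
    exact h
  rw [e1]
  -- square roots and bookkeeping
  have hnormf : ∫ x, ‖(f : VF) x‖ ^ 2 = ‖f‖ ^ 2 := (OneLevelSplit.norm_sq_eq_integral f).symm
  have hcard : (Fintype.card (Fin 3) : ℝ) = 3 := by simp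
  have hGval : G (t - s) = ((12 * k₀ * (Real.sqrt (freqNormSq ℓ) / n) / (Real.pi ^ 2 * lo)) *
        Real.exp (18 * (k₀ : ℝ) ^ 2 * (freqNormSq ℓ / (n : ℝ) ^ 2) * (t - s) / (Real.pi ^ 2 * lo)) * ‖f‖) ^ 2 := by
    rw [hG]; dsimp only
    rw [hnormf, hcard]
    have hpi : Real.pi ≠ 0 := Real.pi_pos.ne'
    have hn' : (n:ℝ) ≠ 0 := hn0.ne'
    have hlo0 : lo ≠ 0 := hlo.ne'
    have hsq : Real.sqrt (freqNormSq ℓ) ^ 2 = freqNormSq ℓ := Real.sq_sqrt (freqNormSq_nonneg ℓ)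
    have hexp2 : ∀ a : ℝ, Real.exp a ^ 2 = Real.exp (2 * a) := fun a => by rw [← Real.exp_nat_mul]; norm_num
    -- the two exponents agree
    have e2 : (2 * 3 * (k₀ / (2 * Real.pi * n)) * Real.sqrt (freqNormSq ℓ)) ^ 2 / ((1 / (n : ℝ) ^ 2 * lo) * ((n : ℝ) ^ 2 / 4)) * (t - s) =
        2 * (18 * (k₀ : ℝ) ^ 2 * (freqNormSq ℓ / (n : ℝ) ^ 2) * (t - s) / (Real.pi ^ 2 * lo)) := by
      rw [mul_pow, mul_pow, hsq]; field_simp; ring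
    -- the two prefactors agree
    have e3 : (2 * 3 * (k₀ / (2 * Real.pi * n)) * Real.sqrt (freqNormSq ℓ)) ^ 2 / (Real.pi * (1 / (n : ℝ) ^ 2 * lo) * ((n : ℝ) ^ 2 / 4)) ^ 2 =
        (12 * k₀ * (Real.sqrt (freqNormSq ℓ) / n) / (Real.pi ^ 2 * lo)) ^ 2 := by
      field_simp; ring
    rw [e2, e3, ← hexp2]
    ring
  rw [hGval] at key
  have hrhs0 : 0 ≤ (12 * k₀ * (Real.sqrt (freqNormSq ℓ) / n) / (Real.pi ^ 2 * lo)) *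
        Real.exp (18 * (k₀ : ℝ) ^ 2 * (freqNormSq ℓ / (n : ℝ) ^ 2) * (t - s) / (Real.pi ^ 2 * lo)) * ‖f‖ := by positivity
  exact (pow_le_pow_iff_left₀ (norm_nonneg _) hrhs0 two_ne_zero).1 key

end Summit.AnomalousDissipation.AnomalousDissipation.Theorems.SolenoidalFractalHomogenisation.LagrangianStep.VmodGen

end
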